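import Mathlib
import HarnessLib
import Literature.MathematicalPhysics.StatisticalMechanics.WeightTower
import Literature.MathematicalPhysics.StatisticalMechanics.GradientFieldNorms
import Literature.MathematicalPhysics.StatisticalMechanics.RelevantHamiltonians
import Literature.MathematicalPhysics.StatisticalMechanics.TorusMultiplierMatrices

/-!
# Local quadratic forms `Tᵀ diag(χ) T` and the higher-derivative operators `M_k^X`
# (Adams–Buchholz–Kotecký–Müller (7.2)–(7.3), (7.6))

The operators added to the weights of [ABKM19] Ch. 7 are local quadratic forms in the iterated
lattice gradients:
`(φ, M_k^X φ) = Σ_{1≤|α|≤M} L^{2k(|α|−1)} Σ_x χ_X(x) (∇^αφ(x))²` ((7.2), `χ_X = Σ_{B∈𝓑_k(X)} 1_{B⁺}`),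
`(φ, G_k^X φ) = h_k^{−2} Σ_{1≤|α|≤⌊d/2⌋+1} L^{2k(|α|−1)} Σ_{x∈X} (∇^αφ(x))²` ((7.6)).
This file provides their matrix form and the properties consumed by the abstract weight tower
(`WeightData.Dominated.pert_posSemidef`, `Monotone.pert_mono`, `Local.pert_local`,
`StrongDominated.pert_add/strong_add/strong_le_pert`):

* `conjDiag T χ = Tᵀ diag(χ) T`: quadratic form `Σ_x χ(x)(Tφ)(x)²`, symmetric, `⪰ 0` for `χ ≥ 0`,
  additive and monotone in `χ`, and `IsGradLocal` on `S` whenever `(Tφ)(x) = 0` on `{χ ≠ 0}` for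
  fields constant on `S`;
* `iterDiffMat α` — the matrix of `∇^α` (`GradientFRD.iterDiff`), `iterDiffMat_mulVec`; the stencil
  lemma `iterDiff_apply_eq_zero` (`∇^αψ(x) = 0` if `ψ` vanishes on `x + [0,α]`) and
  `iterDiff_eq_zero_of_const_on` (fields constant on a set containing the stencil);
* `derivForm L k s χ = Σ_{α∈s} L^{2k(|α|−1)} (∇^α)ᵀ diag(χ) ∇^α` — `M_k^X` / `h_k² G_k^X` for the
  appropriate index set `s` and indicator `χ` ((7.2), (7.6)): quadratic form, symmetry, positivity,
  additivity/monotonicity in `χ` ((7.59)), locality, and the comparison with the translation-invariant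
  operator ((7.3): `M_k^X ⪯ θ · M_k`): `dotProduct_derivForm_mulVec_le` and, by Parseval,
  `derivForm L k s 1 ⪯`-identity of quadratic forms with the multiplier `Σ_α L^{2k(|α|−1)}|q^α(κ)|²`
  (`dotProduct_derivForm_one_eq_fourier`).

Everything is proved; no named fact.  What is NOT here: the block-neighbourhood indicators `χ_X`
themselves (TorusPolymers) and the choice of `M`, `δ_k`, `h_k`.

## References
* S. Adams, S. Buchholz, R. Kotecký, S. Müller, arXiv:1910.13564, Ch. 7.1 (7.2)–(7.3), (7.6),
  Lemma 7.6 (7.59)–(7.60) [AdamsBuchholzKoteckyMuller2019].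
-/

noncomputable section

namespace Literature.MathematicalPhysics.StatisticalMechanics.GradientRG

open Finset Matrix
open Literature.MathematicalPhysics.StatisticalMechanics.GradientFRD
  (fwdDiff iterDiff fourierCoeff qpow mulMat)
open Literature.Probability.LatticeModels (torusFourier torusFourier_plancherel_holds)

/-! ## Local quadratic forms `Tᵀ diag(χ) T` -/

section ConjDiag

variable {Λ : Type*} [Fintype Λ] [DecidableEq Λ]

/-- **`conjDiag T χ = Tᵀ · diag(χ) · T`**, the form `φ ↦ Σ_x χ(x) (Tφ)(x)²` (shape of every summand
of `M_k^X`, `G_k^X`). [cite: AdamsBuchholzKoteckyMuller2019, Ch. 7.1 (7.2)] -/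
def conjDiag (T : Matrix Λ Λ ℝ) (χ : Λ → ℝ) : Matrix Λ Λ ℝ :=
  Tᵀ * Matrix.diagonal χ * T

/-- `(φ, conjDiag T χ φ) = Σ_x χ(x) (Tφ)(x)²`. [cite: AdamsBuchholzKoteckyMuller2019, Ch. 7.1 (7.2)] -/
theorem dotProduct_conjDiag_mulVec (T : Matrix Λ Λ ℝ) (χ φ : Λ → ℝ) :
    φ ⬝ᵥ conjDiag T χ *ᵥ φ = ∑ x, χ x * (T *ᵥ φ) x ^ 2 := by
  rw [conjDiag, ← Matrix.mulVec_mulVec, ← Matrix.mulVec_mulVec, Matrix.dotProduct_mulVec,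
    Matrix.vecMul_transpose]
  simp only [dotProduct, Matrix.mulVec_diagonal]
  exact sum_congr rfl fun x _ => by ring

/-- `conjDiag T χ` is symmetric. [cite: AdamsBuchholzKoteckyMuller2019, Lemma 7.5 (i)] -/
theorem isSymm_conjDiag (T : Matrix Λ Λ ℝ) (χ : Λ → ℝ) : (conjDiag T χ).IsSymm := by
  unfold Matrix.IsSymm conjDiag
  rw [Matrix.transpose_mul, Matrix.transpose_mul, Matrix.transpose_transpose, Matrix.diagonal_transpose,
    Matrix.mul_assoc]

/-- `conjDiag T χ ⪰ 0` for `χ ≥ 0`. [cite: AdamsBuchholzKoteckyMuller2019, Lemma 7.5 (i)] -/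
theorem posSemidef_conjDiag (T : Matrix Λ Λ ℝ) {χ : Λ → ℝ} (hχ : ∀ x, 0 ≤ χ x) :
    (conjDiag T χ).PosSemidef := by
  refine Matrix.PosSemidef.of_dotProduct_mulVec_nonneg (isHermitian_iff_isSymm.2 (isSymm_conjDiag T χ))
    fun φ => ?_
  rw [star_trivial, dotProduct_conjDiag_mulVec]
  exact sum_nonneg fun x _ => mul_nonneg (hχ x) (sq_nonneg _)

/-- Additivity in the weight: `conjDiag T (χ₁ + χ₂) = conjDiag T χ₁ + conjDiag T χ₂` ((7.59)).
[cite: AdamsBuchholzKoteckyMuller2019, Lemma 7.6 (7.59)] -/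
theorem conjDiag_add (T : Matrix Λ Λ ℝ) (χ₁ χ₂ : Λ → ℝ) :
    conjDiag T (χ₁ + χ₂) = conjDiag T χ₁ + conjDiag T χ₂ := by
  have hd : Matrix.diagonal (χ₁ + χ₂) = Matrix.diagonal χ₁ + Matrix.diagonal χ₂ := by
    rw [Matrix.diagonal_add]; rfl
  rw [conjDiag, conjDiag, conjDiag, hd, Matrix.mul_add, Matrix.add_mul]

/-- Homogeneity in the weight. [cite: AdamsBuchholzKoteckyMuller2019, Ch. 7.1 (7.3)] -/
theorem conjDiag_smul (T : Matrix Λ Λ ℝ) (c : ℝ) (χ : Λ → ℝ) :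
    conjDiag T (c • χ) = c • conjDiag T χ := by
  rw [conjDiag, conjDiag]
  have : Matrix.diagonal (c • χ) = c • Matrix.diagonal χ := by
    ext i j
    simp only [Matrix.diagonal, Matrix.smul_apply, Matrix.of_apply, Pi.smul_apply, smul_eq_mul]
    split_ifs <;> simp
  rw [this, Matrix.mul_smul, Matrix.smul_mul]

/-- Monotonicity in the weight: `χ₁ ≤ χ₂ ⇒ conjDiag T χ₁ ⪯ conjDiag T χ₂`.
[cite: AdamsBuchholzKoteckyMuller2019, Lemma 7.5 (iv)] -/
theorem conjDiag_mono (T : Matrix Λ Λ ℝ) {χ₁ χ₂ : Λ → ℝ} (h : ∀ x, χ₁ x ≤ χ₂ x) :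
    (conjDiag T χ₂ - conjDiag T χ₁).PosSemidef := by
  have : conjDiag T χ₂ - conjDiag T χ₁ = conjDiag T (χ₂ - χ₁) := by
    rw [sub_eq_iff_eq_add, ← conjDiag_add, sub_add_cancel]
  rw [this]
  exact posSemidef_conjDiag T fun x => sub_nonneg.2 (h x)

/-- **Locality criterion**: if `(Tφ)(x) = 0` at every `x` with `χ(x) ≠ 0` whenever `φ` is constant on
`S`, then `conjDiag T χ` is `IsGradLocal` on `S`. [cite: AdamsBuchholzKoteckyMuller2019, Lemma 7.5 (iii)] -/
theorem isGradLocal_conjDiag (T : Matrix Λ Λ ℝ) (χ : Λ → ℝ) {S : Finset Λ}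
    (h : ∀ φ : Λ → ℝ, (∀ x ∈ S, ∀ y ∈ S, φ x = φ y) → ∀ x, χ x ≠ 0 → (T *ᵥ φ) x = 0) :
    IsGradLocal (conjDiag T χ) S := by
  intro φ hφ
  have h0 : Matrix.diagonal χ *ᵥ (T *ᵥ φ) = 0 := by
    funext x
    rw [Matrix.mulVec_diagonal, Pi.zero_apply]
    by_cases hx : χ x = 0
    · rw [hx, zero_mul]
    · rw [h φ hφ x hx, mul_zero]
  rw [conjDiag, ← Matrix.mulVec_mulVec, ← Matrix.mulVec_mulVec, h0, Matrix.mulVec_zero]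

end ConjDiag

/-! ## The matrices of the iterated gradients and their stencil -/

section Torus

variable {d M : ℕ} [NeZero M]

/-- **The matrix of `∇^α`** (`GradientFRD.iterDiff`). [cite: AdamsBuchholzKoteckyMuller2019, App. A.5 (discrete derivatives)] -/
def iterDiffMat (α : Fin d → ℕ) : Matrix (Fin d → ZMod M) (Fin d → ZMod M) ℝ :=
  LinearMap.toMatrix' (iterDiffₗ (M := M) α)

/-- `iterDiffMat α φ = ∇^α φ`. [cite: AdamsBuchholzKoteckyMuller2019, App. A.5 (discrete derivatives)] -/
@[simp] theorem iterDiffMat_mulVec (α : Fin d → ℕ) (φ : (Fin d → ZMod M) → ℝ) :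
    iterDiffMat α *ᵥ φ = iterDiff α φ := by
  rw [iterDiffMat, LinearMap.toMatrix'_mulVec, iterDiffₗ_apply]

omit [NeZero M] in
/-- One-directional stencil: `(∇_i^{[n]} g)(x) = 0` if `g(x + j e_i) = 0` for all `j ≤ n`.
[cite: AdamsBuchholzKoteckyMuller2019, App. A.5 (discrete derivatives)] -/
theorem iterate_fwdDiff_apply_eq_zero (i : Fin d) (n : ℕ) (g : (Fin d → ZMod M) → ℝ)
    (x : Fin d → ZMod M) (h : ∀ j : ℕ, j ≤ n → g (x + (j : ZMod M) • Pi.single i (1 : ZMod M)) = 0) :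
    ((fwdDiff i)^[n] g) x = 0 := by
  induction n generalizing x with
  | zero =>
    have := h 0 le_rfl
    rwa [Nat.cast_zero, zero_smul, add_zero] at this
  | succ n ih =>
    have h1 : ((fwdDiff i)^[n] g) x = 0 := ih x fun j hj => h j (hj.trans (Nat.le_succ n))
    have h2 : ((fwdDiff i)^[n] g) (x + Pi.single i 1) = 0 := by
      refine ih (x + Pi.single i 1) fun j hj => ?_
      have := h (j + 1) (Nat.succ_le_succ hj)
      rw [← this]
      congr 1
      simp only [Nat.cast_succ, add_smul, one_smul]
      abel
    rw [Function.iterate_succ_apply']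
    show ((fwdDiff i)^[n] g) (x + Pi.single i 1) - ((fwdDiff i)^[n] g) x = 0
    rw [h1, h2, sub_self]

omit [NeZero M] in
/-- **Stencil of `∇^α`**: `(∇^αψ)(x) = 0` if `ψ(x + β) = 0` for all multi-indices `β ≤ α`
(`β` cast to the torus). [cite: AdamsBuchholzKoteckyMuller2019, App. A.5 (discrete derivatives)] -/
theorem iterDiff_apply_eq_zero (α : Fin d → ℕ) (ψ : (Fin d → ZMod M) → ℝ) (x : Fin d → ZMod M)
    (h : ∀ β : Fin d → ℕ, (∀ i, β i ≤ α i) → ψ (x + fun i => ((β i : ℕ) : ZMod M)) = 0) :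
    iterDiff α ψ x = 0 := by
  -- induction over the list of directions, keeping the set of directions already used
  have key : ∀ l : List (Fin d), l.Nodup → ∀ y : Fin d → ZMod M,
      (∀ β : Fin d → ℕ, (∀ i, β i ≤ α i) → (∀ i, i ∉ l → β i = 0) →
        ψ (y + fun i => ((β i : ℕ) : ZMod M)) = 0) →
      (l.foldr (fun i g => (fwdDiff i)^[α i] g) ψ) y = 0 := by
    intro l
    induction l with
    | nil =>
      intro _ y hy
      have := hy 0 (fun i => Nat.zero_le _) (fun i _ => rfl)
      have h0 : (fun i : Fin d => (((0 : Fin d → ℕ) i : ℕ) : ZMod M)) = 0 := by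
        funext i; simp
      rw [h0, add_zero] at this
      simpa using this
    | cons i l ih =>
      intro hnd y hy
      rw [List.nodup_cons] at hnd
      rw [List.foldr_cons]
      refine iterate_fwdDiff_apply_eq_zero i (α i) _ y fun j hj => ih hnd.2 _ fun β hβ hβl => ?_
      -- the shift `j e_i + β` with `β` supported on `l`
      have hβi : β i = 0 := hβl i hnd.1
      set β' : Fin d → ℕ := β + Pi.single i j with hβ'
      have hβ'i : β' i = j := by simp [hβ', hβi]
      have hβ'k : ∀ k, k ≠ i → β' k = β k := fun k hk => by simp [hβ', hk]
      have hle : ∀ i', β' i' ≤ α i' := fun i' => by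
        by_cases hi' : i' = i
        · rw [hi', hβ'i]; exact hj
        · rw [hβ'k i' hi']; exact hβ i'
      have hsupp : ∀ i', i' ∉ i :: l → β' i' = 0 := fun i' hi' => by
        rw [List.mem_cons, not_or] at hi'
        rw [hβ'k i' hi'.1]; exact hβl i' hi'.2
      have hshift : ((j : ZMod M) • Pi.single i (1 : ZMod M) + fun k => ((β k : ℕ) : ZMod M)) =
          fun k => ((β' k : ℕ) : ZMod M) := by
        funext k
        by_cases hk : k = i
        · rw [hk, hβ'i, Pi.add_apply, Pi.smul_apply, Pi.single_eq_same, hβi, smul_eq_mul, mul_one,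
            Nat.cast_zero, add_zero]
        · rw [hβ'k k hk, Pi.add_apply, Pi.smul_apply, Pi.single_eq_of_ne hk, smul_zero, zero_add]
      have := hy β' hle hsupp
      rw [← hshift, ← add_assoc] at this
      exact this
  exact key (List.finRange d) (List.nodup_finRange d) x fun β hβ _ => h β hβ

omit [NeZero M] in
/-- **Locality of `∇^α`**: if `|α| ≥ 1` and `φ` is constant on a set `S` containing the stencil
`x + [0, α]`, then `(∇^αφ)(x) = 0`. [cite: AdamsBuchholzKoteckyMuller2019, Lemma 7.5 (iii)] -/
theorem iterDiff_eq_zero_of_const_on {α : Fin d → ℕ} (hα : 1 ≤ ∑ i, α i) {S : Finset (Fin d → ZMod M)}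
    (φ : (Fin d → ZMod M) → ℝ) (hφ : ∀ x ∈ S, ∀ y ∈ S, φ x = φ y) (x : Fin d → ZMod M)
    (hS : ∀ β : Fin d → ℕ, (∀ i, β i ≤ α i) → (x + fun i => ((β i : ℕ) : ZMod M)) ∈ S) :
    iterDiff α φ x = 0 := by
  have hx : x ∈ S := by
    have := hS 0 (fun i => Nat.zero_le _)
    have h0 : (fun i : Fin d => (((0 : Fin d → ℕ) i : ℕ) : ZMod M)) = 0 := by
      funext i; simp
    rwa [h0, add_zero] at this
  -- `φ = φ(x) + ψ` with `ψ` vanishing on `S`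
  set ψ : (Fin d → ZMod M) → ℝ := fun y => φ y - φ x with hψ
  have hdec : φ = (fun _ => φ x) + ψ := by funext y; simp [hψ]
  rw [hdec, iterDiff_add, iterDiff_const_eq_zero hα, Pi.add_apply, Pi.zero_apply, zero_add]
  exact iterDiff_apply_eq_zero α ψ x fun β hβ => by
    simp only [hψ]
    rw [hφ _ (hS β hβ) _ hx, sub_self]

/-! ## The higher-derivative forms `M_k^X`, `G_k^X` ((7.2), (7.6)) -/

/-- **`derivForm L k s χ = Σ_{α∈s} L^{2k(|α|−1)} (∇^α)ᵀ diag(χ) ∇^α`** — with `s = diffIndex d M`,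
`χ = χ_X` this is `M_k^X` ((7.2)); with `s = diffIndex d (⌊d/2⌋+1)`, `χ = 1_X` it is `h_k² G_k^X`
((7.6)). [cite: AdamsBuchholzKoteckyMuller2019, Ch. 7.1 (7.2)] -/
def derivForm (L : ℝ) (k : ℕ) (s : Finset (Fin d → ℕ)) (χ : (Fin d → ZMod M) → ℝ) :
    Matrix (Fin d → ZMod M) (Fin d → ZMod M) ℝ :=
  ∑ α ∈ s, L ^ (2 * k * (∑ i, α i - 1)) • conjDiag (iterDiffMat α) χ

/-- `(φ, derivForm φ) = Σ_{α∈s} L^{2k(|α|−1)} Σ_x χ(x) (∇^αφ(x))²`.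
[cite: AdamsBuchholzKoteckyMuller2019, Ch. 7.1 (7.2)] -/
theorem dotProduct_derivForm_mulVec (L : ℝ) (k : ℕ) (s : Finset (Fin d → ℕ))
    (χ φ : (Fin d → ZMod M) → ℝ) :
    φ ⬝ᵥ derivForm L k s χ *ᵥ φ =
      ∑ α ∈ s, L ^ (2 * k * (∑ i, α i - 1)) * ∑ x, χ x * iterDiff α φ x ^ 2 := by
  rw [derivForm, Matrix.sum_mulVec, dotProduct_sum]
  refine sum_congr rfl fun α _ => ?_
  rw [Matrix.smul_mulVec, dotProduct_smul, smul_eq_mul, dotProduct_conjDiag_mulVec, iterDiffMat_mulVec]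

/-- `derivForm` is symmetric. [cite: AdamsBuchholzKoteckyMuller2019, Lemma 7.5 (i)] -/
theorem isSymm_derivForm (L : ℝ) (k : ℕ) (s : Finset (Fin d → ℕ)) (χ : (Fin d → ZMod M) → ℝ) :
    (derivForm L k s χ).IsSymm := by
  unfold Matrix.IsSymm derivForm
  rw [Matrix.transpose_sum]
  exact sum_congr rfl fun α _ => by rw [Matrix.transpose_smul, (isSymm_conjDiag _ _).eq]

/-- `derivForm ⪰ 0` for `χ ≥ 0`, `L ≥ 0`. [cite: AdamsBuchholzKoteckyMuller2019, Lemma 7.5 (i)] -/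
theorem posSemidef_derivForm {L : ℝ} (hL : 0 ≤ L) (k : ℕ) (s : Finset (Fin d → ℕ))
    {χ : (Fin d → ZMod M) → ℝ} (hχ : ∀ x, 0 ≤ χ x) : (derivForm L k s χ).PosSemidef := by
  unfold derivForm
  exact Matrix.posSemidef_sum _ fun α _ => (posSemidef_conjDiag _ hχ).smul (pow_nonneg hL _)

/-- **Additivity in the indicator** ((7.59): `M_k^{X∪Y} = M_k^X + M_k^Y` for `χ_{X∪Y} = χ_X + χ_Y`).
[cite: AdamsBuchholzKoteckyMuller2019, Lemma 7.6 (7.59)] -/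
theorem derivForm_add (L : ℝ) (k : ℕ) (s : Finset (Fin d → ℕ)) (χ₁ χ₂ : (Fin d → ZMod M) → ℝ) :
    derivForm L k s (χ₁ + χ₂) = derivForm L k s χ₁ + derivForm L k s χ₂ := by
  simp only [derivForm, conjDiag_add, smul_add, sum_add_distrib]

/-- Homogeneity in the indicator ((7.3): `M_k^Λ = θ_k M_k`).
[cite: AdamsBuchholzKoteckyMuller2019, Ch. 7.1 (7.3)] -/
theorem derivForm_smul (L : ℝ) (k : ℕ) (s : Finset (Fin d → ℕ)) (c : ℝ) (χ : (Fin d → ZMod M) → ℝ) :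
    derivForm L k s (c • χ) = c • derivForm L k s χ := by
  simp only [derivForm, conjDiag_smul, smul_comm c, smul_sum]

/-- **Monotonicity in the indicator** (`χ₁ ≤ χ₂ ⇒ M ⪯`; Lemma 7.5 (iv) for `M_k^X`, `Y ⊆ X`).
[cite: AdamsBuchholzKoteckyMuller2019, Lemma 7.5 (iv)] -/
theorem derivForm_mono {L : ℝ} (hL : 0 ≤ L) (k : ℕ) (s : Finset (Fin d → ℕ))
    {χ₁ χ₂ : (Fin d → ZMod M) → ℝ} (h : ∀ x, χ₁ x ≤ χ₂ x) :
    (derivForm L k s χ₂ - derivForm L k s χ₁).PosSemidef := by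
  have : derivForm L k s χ₂ - derivForm L k s χ₁ = derivForm L k s (χ₂ - χ₁) := by
    rw [sub_eq_iff_eq_add, ← derivForm_add, sub_add_cancel]
  rw [this]
  exact posSemidef_derivForm hL k s fun x => sub_nonneg.2 (h x)

/-- **Locality** (Lemma 7.5 (iii) for `M_k^X`): if every `α ∈ s` has `|α| ≥ 1` and `S` contains the
stencil `x + [0,α]` of every point `x` with `χ(x) ≠ 0`, then `derivForm L k s χ` is `IsGradLocal` on `S`.
[cite: AdamsBuchholzKoteckyMuller2019, Lemma 7.5 (iii)] -/
theorem isGradLocal_derivForm (L : ℝ) (k : ℕ) {s : Finset (Fin d → ℕ)} (hs : ∀ α ∈ s, 1 ≤ ∑ i, α i)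
    {χ : (Fin d → ZMod M) → ℝ} {S : Finset (Fin d → ZMod M)}
    (hS : ∀ x, χ x ≠ 0 → ∀ α ∈ s, ∀ β : Fin d → ℕ, (∀ i, β i ≤ α i) →
      (x + fun i => ((β i : ℕ) : ZMod M)) ∈ S) :
    IsGradLocal (derivForm L k s χ) S := by
  intro φ hφ
  rw [derivForm, Matrix.sum_mulVec]
  refine sum_eq_zero fun α hα => ?_
  rw [Matrix.smul_mulVec, (isGradLocal_conjDiag (iterDiffMat α) χ fun φ' hφ' x hx => ?_) φ hφ,
    smul_zero]
  rw [iterDiffMat_mulVec]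
  exact iterDiff_eq_zero_of_const_on (hs α hα) φ' hφ' x fun β hβ => hS x hx α hα β hβ

/-! ## Comparison with the translation-invariant operator ((7.3)) -/

/-- The quadratic form is monotone in the indicator: `χ ≤ θ ⇒ (φ, M^χ φ) ≤ θ (φ, M^1 φ)`.
[cite: AdamsBuchholzKoteckyMuller2019, Ch. 7.1 (7.3)] -/
theorem dotProduct_derivForm_mulVec_le {L : ℝ} (hL : 0 ≤ L) (k : ℕ) (s : Finset (Fin d → ℕ))
    {χ : (Fin d → ZMod M) → ℝ} {θ : ℝ} (hχ : ∀ x, χ x ≤ θ) (φ : (Fin d → ZMod M) → ℝ) :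
    φ ⬝ᵥ derivForm L k s χ *ᵥ φ ≤ θ * (φ ⬝ᵥ derivForm L k s (fun _ => 1) *ᵥ φ) := by
  rw [dotProduct_derivForm_mulVec, dotProduct_derivForm_mulVec, mul_sum]
  refine sum_le_sum fun α _ => ?_
  rw [mul_left_comm]
  refine mul_le_mul_of_nonneg_left ?_ (pow_nonneg hL _)
  rw [mul_sum]
  exact sum_le_sum fun x _ => by
    rw [one_mul]; exact mul_le_mul_of_nonneg_right (hχ x) (sq_nonneg _)

/-- **Parseval for the iterated gradient**: `Σ_x (∇^αφ(x))² = M^{-d} Σ_κ |q^α(κ)|² |φ̂(κ)|²`.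
[cite: AdamsBuchholzKoteckyMuller2019, Remark 7.4 ((7.32))] -/
theorem sum_sq_iterDiff_eq_fourier (α : Fin d → ℕ) (φ : (Fin d → ZMod M) → ℝ) :
    ∑ x, iterDiff α φ x ^ 2 =
      (((M : ℝ) ^ d))⁻¹ * ∑ κ, ‖qpow α κ‖ ^ 2 * ‖fourierCoeff φ κ‖ ^ 2 := by
  have hP := torusFourier_plancherel_holds (d := d) (L := M) (fun x => (iterDiff α φ x : ℂ))
  simp_rw [Literature.MathematicalPhysics.StatisticalMechanics.GradientFRD.torusFourier_ofReal,
    Literature.MathematicalPhysics.StatisticalMechanics.GradientFRD.fourierCoeff_iterDiff, norm_mul,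
    mul_pow, Complex.norm_real, Real.norm_eq_abs, sq_abs] at hP
  have hM : ((M : ℝ) ^ d) ≠ 0 := pow_ne_zero _ (by exact_mod_cast (NeZero.ne M))
  rw [eq_inv_mul_iff_mul_eq₀ hM, ← hP]

/-- **`(φ, M_k^1 φ)` in Fourier variables**: with the multiplier
`m(κ) = Σ_{α∈s} L^{2k(|α|−1)} |q^α(κ)|²`, `(φ, derivForm L k s 1 φ) = (φ, mulMat m φ)` ((7.32)).
[cite: AdamsBuchholzKoteckyMuller2019, Remark 7.4 (7.32)] -/
theorem dotProduct_derivForm_one_eq_mulMat (L : ℝ) (k : ℕ) (s : Finset (Fin d → ℕ))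
    (φ : (Fin d → ZMod M) → ℝ) :
    φ ⬝ᵥ derivForm L k s (fun _ => 1) *ᵥ φ =
      φ ⬝ᵥ mulMat (fun κ => ∑ α ∈ s, L ^ (2 * k * (∑ i, α i - 1)) * ‖qpow α κ‖ ^ 2) *ᵥ φ := by
  rw [dotProduct_derivForm_mulVec,
    Literature.MathematicalPhysics.StatisticalMechanics.GradientFRD.dotProduct_mulMat_mulVec]
  simp_rw [one_mul, sum_sq_iterDiff_eq_fourier, sum_mul, mul_sum]
  rw [sum_comm]
  exact sum_congr rfl fun α _ => sum_congr rfl fun κ _ => by ring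

/-- **(7.3) in operator form**: `χ ≤ θ ⇒ derivForm L k s χ ⪯ θ · mulMat m` with
`m = Σ_{α∈s} L^{2k(|α|−1)}|q^α|²` — the translation-invariant dominator of `M_k^X` used in Lemma 7.5 (v)
and Lemma 7.7 (7.72). [cite: AdamsBuchholzKoteckyMuller2019, Ch. 7.1 (7.3)] -/
theorem derivForm_le_smul_mulMat {L : ℝ} (hL : 0 ≤ L) (k : ℕ) (s : Finset (Fin d → ℕ))
    {χ : (Fin d → ZMod M) → ℝ} {θ : ℝ} (hχ : ∀ x, χ x ≤ θ) :
    (θ • mulMat (fun κ => ∑ α ∈ s, L ^ (2 * k * (∑ i, α i - 1)) * ‖qpow α κ‖ ^ 2) -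
      derivForm L k s χ).PosSemidef := by
  have hsymm : (θ • mulMat (fun κ => ∑ α ∈ s, L ^ (2 * k * (∑ i, α i - 1)) * ‖qpow α κ‖ ^ 2) -
      derivForm L k s χ).IsHermitian := by
    rw [isHermitian_iff_isSymm]
    exact ((Literature.MathematicalPhysics.StatisticalMechanics.GradientFRD.isSymm_mulMat _).smul θ).sub
      (isSymm_derivForm L k s χ)
  refine Matrix.PosSemidef.of_dotProduct_mulVec_nonneg hsymm fun φ => ?_
  rw [star_trivial, Matrix.sub_mulVec, dotProduct_sub, Matrix.smul_mulVec, dotProduct_smul, smul_eq_mul,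
    ← dotProduct_derivForm_one_eq_mulMat]
  linarith [dotProduct_derivForm_mulVec_le hL k s hχ φ]

end Torus

end Literature.MathematicalPhysics.StatisticalMechanics.GradientRG

end
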